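import Mathlib
import HarnessLib
import Summits.QuantumAdvantage.QuantumAdvantage.Theorems.DigitDialB

set_option linter.dupNamespace false
set_option autoImplicit false

/-!
# DigitDial (D) — `K` LINEAR FORMS MOD A GENERAL `M`: the minimum-distance bound (cell decomp-qadv, lens 4, g20 rev 2)

Prop-definition-free tree twin of §7a–§7b of the lens-4 g20 node `DigitDial` (supports the Young-symmetric sub-case of item
OddPrimeWalk:23109 `ManyReadersSqrtOdd`).
* `linVal` / `linStrat` — strategies `y_g(u) = tab_g(λ₁·u, …, λ_K·u)` reading `K` linear forms of the input mod `M`;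
* `card_cell_win_le` — wins inside one cell `{u : λ·u = v}` of a constant-firing-set game: `≤ θ₀·2ⁿ/M^K + 3ρ^s·2ⁿ`
  (`ρ = cos(π/3M)`, `s` = minimum distance of the forms), from the Literature expansion `TwoModuli.sum_cell_eq_sum_twisted`
  (`[NeZero M]`) and the general-modulus twisted transfer of `DigitDialA`;
* `card_win_linStrat_le` — for `3 ∤ M`, `n ≥ 4`: `#WIN(linStrat λ tab) ≤ (3/4 + 3·M^K·cos(π/3M)^s)·2ⁿ` — the `ℤ/M` form of
  the tree's `card_win_le_of_minDistance` (`WalkHardFLinFormsSqrt.lean`, prime moduli);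
* `blockForm`, `blockForm_dist` — indicator forms of pairwise disjoint blocks have minimum distance `≥ min_b |W_b|`;
* `pow_twist_small`, `block_hyp` — `3·M^K·cos(π/3M)^s ≤ 1/8` once `s ≥ 4M²(KM+4)`, and the polylog bookkeeping;
* rev 3: `linStrat_card_win_le_fin` (finite form, `≤ (7/8)·2ⁿ`) and `spreadLinM_card_win_le` (explicit rung: `K ≤ (log₂ n)^C`
  forms mod `M ≤ (log₂ n)^C`, `3 ∤ M`, minimum distance `≥ (log₂ n)^{4C+6}`, `n ≥ 16` — the `ℤ/M` companion of R11° `walkHardFLinFormsCode`).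
0 sorry; axioms standard; no `instance`, no `notation`, no `native_decide`; no `def … : Prop`.
-/

noncomputable section

namespace Summit.QuantumAdvantage.QuantumAdvantage.Theorems.DigitDial

open Finset Summit.QuantumAdvantage.AdviceFreeQNC0 Literature.Computability.MetaComplexity
open TwistedTransfer ConstBells

/-! ##  YOUNG-SYMMETRIC strategies (gen 20 extension): `K` linear forms mod a GENERAL modulus `M` with a
minimum-distance condition, and block-symmetric strategies via window-Lucas periodicity

The symmetric rung `SymmetricHardOdd` (`B = 1` block) extends to strategies that are symmetric only under a YOUNG
subgroup `S_{W₁} × ⋯ × S_{W_B}` of a partition of the coordinates into `B ≤ (log₂ n)^C` blocks of size `≥ (log₂ n)^{4C+6}`: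
by Lucas periodicity on each block (`symmOn_periodic`, the window version of §4) such a strategy of `𝔽_p`-degree `d < p^K`
reads only the BLOCK WEIGHTS mod `p^K` (`blockSymm_factor`), i.e. `B` linear forms mod `p^K` whose nonzero combinations
have support `≥ min_b |W_b|`; and strategies reading `K` linear forms mod ANY `M` coprime to `3` whose span has minimum
distance `s` win the u-walk game on at most `(3/4 + 3·M^K·cos(π/3M)^s)·2ⁿ` inputs (`card_win_linStrat_le`, the
general-modulus form of the tree's `card_win_le_of_minDistance`, via `TwoModuli.sum_cell_eq_sum_twisted` + §1). -/

section LinFormsM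

variable {n K : ℕ} {M : ℕ} [NeZero M]

/-- The residue vector of `K` linear forms mod `M` at the input `u`. -/
def linVal (lam : Fin K → Fin n → ZMod M) (u : Fin n → Bool) : Fin K → ZMod M :=
  fun j => ∑ i, if u i then lam j i else 0

/-- A strategy reading `K` linear forms mod `M` through arbitrary tables. -/
def linStrat (lam : Fin K → Fin n → ZMod M) (tab : Fin (n + 1) → (Fin K → ZMod M) → Bool) :
    Fin (n + 1) → (Fin n → Bool) → Bool := fun g u => tab g (linVal lam u)

/-- The constant strategy played on the cell `ℓ(u) = v`. -/
def cellY (tab : Fin (n + 1) → (Fin K → ZMod M) → Bool) (v : Fin K → ZMod M) : Finset (Fin (n + 1)) :=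
  univ.filter fun g => tab g v = true

omit [NeZero M] in
/-- On the cell `ℓ(u) = v` the strategy IS the constant strategy `cellY tab v`. [bookkeeping] -/
theorem ringWinU_linStrat_cell (c : ℕ) (lam : Fin K → Fin n → ZMod M)
    (tab : Fin (n + 1) → (Fin K → ZMod M) → Bool) {u : Fin n → Bool} {v : Fin K → ZMod M}
    (hu : linVal lam u = v) :
    ringWinU c (linStrat lam tab) u = ringWinU c (fun g _ => decide (g ∈ cellY tab v)) u := by
  refine Summit.QuantumAdvantage.AdviceFreeQNC0.UnreadTwist.ringWinU_congr fun g => ?_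
  unfold linStrat cellY
  rw [hu]
  simp

/-- **The cell count through characters** (general modulus, minimum distance `s`): for a constant strategy `Y` with
`#WIN_Y ≤ θ₀·2ⁿ` and `K` forms every nonzero combination of which has `≥ s` nonzero coefficients,
`#{u : ℓ(u) = v, WIN_Y(u)} ≤ θ₀·2ⁿ/M^K + 3·cos(π/(3M))^s·2ⁿ` (`3 ∤ M`). -/
theorem card_cell_win_le (hM3 : M.Coprime 3) (c : ℕ) (Y : Finset (Fin (n + 1))) (lam : Fin K → Fin n → ZMod M)
    (v : Fin K → ZMod M) {θ₀ : ℝ} {s : ℕ}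
    (hY : ((univ.filter fun u : Fin n → Bool => ringWinU c (fun g _ => decide (g ∈ Y)) u = true).card : ℝ) ≤
      θ₀ * (2 : ℝ) ^ n)
    (hdist : ∀ γ : Fin K → ZMod M, γ ≠ 0 → s ≤ (univ.filter fun i : Fin n => (∑ j, γ j * lam j i) ≠ 0).card) :
    ((univ.filter fun u : Fin n → Bool =>
        ringWinU c (fun g _ => decide (g ∈ Y)) u = true ∧ linVal lam u = v).card : ℝ) ≤
      θ₀ * (2 : ℝ) ^ n / (M : ℝ) ^ K + 3 * Real.cos (Real.pi / (3 * M)) ^ s * (2 : ℝ) ^ n := by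
  classical
  set ρ := Real.cos (Real.pi / (3 * M)) with hρ
  have hρ0 : 0 ≤ ρ := TwistM.cos_nonneg M
  have hρ1 : ρ ≤ 1 := Real.cos_le_one _
  set W : (Fin n → Bool) → Prop := fun u => ringWinU c (fun g _ => decide (g ∈ Y)) u = true with hW
  set F : (Fin n → Bool) → ℂ := fun u => if W u then (1 : ℂ) else 0 with hF
  have hMK : ((M : ℂ) ^ K) ≠ 0 := pow_ne_zero _ (by exact_mod_cast NeZero.ne M)
  -- the twisted sums
  set T : (Fin K → ZMod M) → ℂ := fun γ => ∑ u : Fin n → Bool,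
    (ZMod.stdAddChar (∑ i : Fin n, if u i then ∑ j, γ j * lam j i else 0) : ℂ) * F u with hT
  -- Step 1: the count as a character sum (`TwoModuli.sum_cell_eq_sum_twisted`)
  have hcount : (((univ.filter fun u : Fin n → Bool => W u ∧ linVal lam u = v).card : ℕ) : ℂ) =
      ((M : ℂ) ^ K)⁻¹ * ∑ γ : Fin K → ZMod M, (ZMod.stdAddChar (-∑ j, γ j * v j) : ℂ) * T γ := by
    rw [Finset.natCast_card_filter]
    have hu : ∀ u : Fin n → Bool, (if W u ∧ linVal lam u = v then (1 : ℂ) else 0) =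
        (if (fun j => ∑ i, if u i then lam j i else 0) = v then F u else 0) := by
      intro u
      show (if W u ∧ linVal lam u = v then (1 : ℂ) else 0) = (if linVal lam u = v then F u else 0)
      by_cases h1 : W u <;> by_cases h2 : linVal lam u = v <;> simp [F, h1, h2]
    simp_rw [hu]
    exact TwoModuli.sum_cell_eq_sum_twisted lam v F
  -- Step 2: bounds on the twisted sums
  have hT0 : ‖T 0‖ ≤ θ₀ * (2 : ℝ) ^ n := by
    have h0 : T 0 = (((univ.filter fun u : Fin n → Bool => W u).card : ℕ) : ℂ) := by
      rw [hT, Finset.natCast_card_filter]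
      refine Finset.sum_congr rfl fun u _ => ?_
      have : (∑ i : Fin n, if u i then ∑ j : Fin K, (0 : Fin K → ZMod M) j * lam j i else 0) = 0 := by simp
      rw [this, AddChar.map_zero_eq_one, one_mul]
    rw [h0, Complex.norm_natCast]
    exact hY
  have hTγ : ∀ γ : Fin K → ZMod M, γ ≠ 0 → ‖T γ‖ ≤ 3 * ρ ^ s * (2 : ℝ) ^ n := by
    intro γ hγ
    have hcomm : T γ = ∑ u : Fin n → Bool, F u *
        (ZMod.stdAddChar (∑ i : Fin n, if u i then (∑ j, γ j * lam j i) else 0) : ℂ) := by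
      rw [hT]
      exact Finset.sum_congr rfl fun u _ => mul_comm _ _
    rw [hcomm]
    refine (TwistM.corr_win_le hρ0 (fun a ha v => TwistM.site_contract hM3 ha v) c Y
      (fun i => ∑ j, γ j * lam j i)).trans ?_
    have hpow : ρ ^ (univ.filter fun i : Fin n => (∑ j, γ j * lam j i) ≠ 0).card ≤ ρ ^ s :=
      pow_le_pow_of_le_one hρ0 hρ1 (hdist γ hγ)
    have h2 : (0 : ℝ) ≤ (2 : ℝ) ^ n := by positivity
    nlinarith
  have hTall : ∀ γ : Fin K → ZMod M, ‖(ZMod.stdAddChar (-∑ j, γ j * v j) : ℂ) * T γ‖ ≤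
      (if γ = 0 then θ₀ * (2 : ℝ) ^ n else 0) + 3 * ρ ^ s * (2 : ℝ) ^ n := by
    intro γ
    rw [norm_mul, ZMod.stdAddChar_apply, Circle.norm_coe, one_mul]
    have hρn : 0 ≤ 3 * ρ ^ s * (2 : ℝ) ^ n := by positivity
    by_cases hγ : γ = 0
    · rw [if_pos hγ, hγ]; linarith
    · rw [if_neg hγ]; linarith [hTγ γ hγ]
  -- Step 3: assemble
  have hcardγ : (Finset.univ : Finset (Fin K → ZMod M)).card = M ^ K := by
    rw [Finset.card_univ, Fintype.card_fun, ZMod.card, Fintype.card_fin]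
  have hsum : ‖∑ γ : Fin K → ZMod M, (ZMod.stdAddChar (-∑ j, γ j * v j) : ℂ) * T γ‖ ≤
      θ₀ * (2 : ℝ) ^ n + (M : ℝ) ^ K * (3 * ρ ^ s * (2 : ℝ) ^ n) := by
    refine (norm_sum_le _ _).trans ?_
    refine (Finset.sum_le_sum fun γ _ => hTall γ).trans ?_
    rw [Finset.sum_add_distrib, Finset.sum_ite_eq' univ (0 : Fin K → ZMod M), if_pos (Finset.mem_univ _),
      Finset.sum_const, hcardγ, nsmul_eq_mul]
    push_cast
    exact le_rfl
  have hreal : (((univ.filter fun u : Fin n → Bool => W u ∧ linVal lam u = v).card : ℕ) : ℝ) =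
      ‖(((univ.filter fun u : Fin n → Bool => W u ∧ linVal lam u = v).card : ℕ) : ℂ)‖ := by
    rw [Complex.norm_natCast]
  have hMr : (0 : ℝ) < (M : ℝ) ^ K := by
    have : (0 : ℝ) < M := by exact_mod_cast Nat.pos_of_ne_zero (NeZero.ne M)
    positivity
  have hMne : ((M : ℝ) ^ K) ≠ 0 := ne_of_gt hMr
  rw [hreal, hcount, norm_mul, norm_inv, norm_pow, Complex.norm_natCast]
  calc ((M : ℝ) ^ K)⁻¹ * ‖∑ γ : Fin K → ZMod M, (ZMod.stdAddChar (-∑ j, γ j * v j) : ℂ) * T γ‖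
      ≤ ((M : ℝ) ^ K)⁻¹ * (θ₀ * (2 : ℝ) ^ n + (M : ℝ) ^ K * (3 * ρ ^ s * (2 : ℝ) ^ n)) :=
        mul_le_mul_of_nonneg_left hsum (by positivity)
    _ = θ₀ * (2 : ℝ) ^ n / (M : ℝ) ^ K + 3 * ρ ^ s * (2 : ℝ) ^ n := by
        rw [mul_add, inv_mul_eq_div, ← mul_assoc, inv_mul_cancel₀ hMne, one_mul]

/-- **`K` linear forms mod `M` with minimum distance `s` lose** (general modulus, arbitrary tables): given a
constant-strategy bound `θ₀` at this `n`, `c`, every strategy `y_g(u) = tab_g(ℓ₁(u), …, ℓ_K(u))` wins on at most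
`(θ₀ + 3·M^K·cos(π/(3M))^s)·2ⁿ` inputs. -/
theorem card_win_linStrat_le_of (hM3 : M.Coprime 3) (c : ℕ) {θ₀ : ℝ}
    (hconst : ∀ Y : Finset (Fin (n + 1)),
      ((univ.filter fun u : Fin n → Bool => ringWinU c (fun g _ => decide (g ∈ Y)) u = true).card : ℝ) ≤ θ₀ * (2 : ℝ) ^ n)
    (lam : Fin K → Fin n → ZMod M) {s : ℕ}
    (hdist : ∀ γ : Fin K → ZMod M, γ ≠ 0 → s ≤ (univ.filter fun i : Fin n => (∑ j, γ j * lam j i) ≠ 0).card)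
    (tab : Fin (n + 1) → (Fin K → ZMod M) → Bool) :
    ((univ.filter fun u : Fin n → Bool => ringWinU c (linStrat lam tab) u = true).card : ℝ) ≤
      (θ₀ + 3 * (M : ℝ) ^ K * Real.cos (Real.pi / (3 * M)) ^ s) * (2 : ℝ) ^ n := by
  classical
  have hsplit := Finset.card_eq_sum_card_fiberwise (f := linVal lam) (s := univ.filter fun u : Fin n → Bool =>
    ringWinU c (linStrat lam tab) u = true) (t := (univ : Finset (Fin K → ZMod M))) (fun _ _ => Finset.mem_univ _)
  have hfib : ∀ v : Fin K → ZMod M, ((univ.filter fun u : Fin n → Bool => ringWinU c (linStrat lam tab) u = true).filter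
      fun u => linVal lam u = v) = univ.filter fun u : Fin n → Bool =>
        ringWinU c (fun g _ => decide (g ∈ cellY tab v)) u = true ∧ linVal lam u = v := by
    intro v
    rw [Finset.filter_filter]
    refine Finset.filter_congr fun u _ => ?_
    constructor
    · rintro ⟨hw, hv⟩; exact ⟨(ringWinU_linStrat_cell c lam tab hv) ▸ hw, hv⟩
    · rintro ⟨hw, hv⟩; exact ⟨(ringWinU_linStrat_cell c lam tab hv).symm ▸ hw, hv⟩
  have hcardγ : (Finset.univ : Finset (Fin K → ZMod M)).card = M ^ K := by
    rw [Finset.card_univ, Fintype.card_fun, ZMod.card, Fintype.card_fin]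
  rw [hsplit]
  push_cast
  calc (∑ v : Fin K → ZMod M, ((((univ.filter fun u : Fin n → Bool => ringWinU c (linStrat lam tab) u = true).filter
          fun u => linVal lam u = v).card : ℕ) : ℝ))
      ≤ ∑ v : Fin K → ZMod M, (θ₀ * (2 : ℝ) ^ n / (M : ℝ) ^ K + 3 * Real.cos (Real.pi / (3 * M)) ^ s * (2 : ℝ) ^ n) := by
        refine Finset.sum_le_sum fun v _ => ?_
        rw [hfib v]
        exact card_cell_win_le hM3 c (cellY tab v) lam v (hconst _) hdist
    _ = (θ₀ + 3 * (M : ℝ) ^ K * Real.cos (Real.pi / (3 * M)) ^ s) * (2 : ℝ) ^ n := by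
        rw [Finset.sum_const, hcardγ, nsmul_eq_mul]
        have hM : (M : ℝ) ^ K ≠ 0 := pow_ne_zero _ (by exact_mod_cast NeZero.ne M)
        push_cast
        have hc : (M : ℝ) ^ K * (θ₀ * (2 : ℝ) ^ n / (M : ℝ) ^ K) = θ₀ * (2 : ℝ) ^ n := by
          field_simp
        rw [mul_add, hc]
        ring

/-- **Corollary (`θ₀ = 3/4`, hidden coins `J_4`).**  For `3 ∤ M`, `n ≥ 4`: `#WIN ≤ (3/4 + 3·M^K·cos(π/(3M))^s)·2ⁿ`. -/
theorem card_win_linStrat_le (hM3 : M.Coprime 3) (hn : 4 ≤ n) (c : ℕ) (lam : Fin K → Fin n → ZMod M) {s : ℕ}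
    (hdist : ∀ γ : Fin K → ZMod M, γ ≠ 0 → s ≤ (univ.filter fun i : Fin n => (∑ j, γ j * lam j i) ≠ 0).card)
    (tab : Fin (n + 1) → (Fin K → ZMod M) → Bool) :
    ((univ.filter fun u : Fin n → Bool => ringWinU c (linStrat lam tab) u = true).card : ℝ) ≤
      (3 / 4 + 3 * (M : ℝ) ^ K * Real.cos (Real.pi / (3 * M)) ^ s) * (2 : ℝ) ^ n := by
  refine card_win_linStrat_le_of hM3 c (fun Y => ?_) lam hdist tab
  exact hiddenCoinsFour n c (∅ : Finset (Fin n)) (by simp; omega) (fun g _ => decide (g ∈ Y)) (fun _ _ _ _ => rfl)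

/-! ### Block forms: the indicator forms of pairwise disjoint blocks have minimum distance `min_b |W_b|` -/

/-- The indicator linear forms of the blocks `W_b`. -/
def blockForm (M : ℕ) {B : ℕ} (W : Fin B → Finset (Fin n)) : Fin B → Fin n → ZMod M :=
  fun b i => if i ∈ W b then 1 else 0

omit [NeZero M] in
/-- A nonzero combination of the block forms is `γ_b` on the block `W_b`. [bookkeeping] -/
theorem sum_mul_blockForm_of_mem {B : ℕ} (W : Fin B → Finset (Fin n)) (hdisj : ∀ b b', b ≠ b' → Disjoint (W b) (W b'))
    (γ : Fin B → ZMod M) {b : Fin B} {i : Fin n} (hi : i ∈ W b) : (∑ j, γ j * blockForm M W j i) = γ b := by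
  rw [Finset.sum_eq_single b]
  · simp [blockForm, hi]
  · intro j _ hjb
    have hij : i ∉ W j := fun h => Finset.disjoint_left.1 (hdisj j b hjb) h hi
    simp [blockForm, hij]
  · intro h; exact absurd (Finset.mem_univ b) h

omit [NeZero M] in
/-- **Minimum distance of the block forms**: every nonzero combination has `≥ min_b |W_b|` nonzero coefficients. -/
theorem blockForm_dist {B : ℕ} (W : Fin B → Finset (Fin n)) (hdisj : ∀ b b', b ≠ b' → Disjoint (W b) (W b'))
    {s : ℕ} (hs : ∀ b, s ≤ (W b).card) (γ : Fin B → ZMod M) (hγ : γ ≠ 0) :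
    s ≤ (univ.filter fun i : Fin n => (∑ j, γ j * blockForm M W j i) ≠ 0).card := by
  obtain ⟨b, hb⟩ : ∃ b, γ b ≠ 0 := by
    by_contra h
    push Not at h
    exact hγ (funext h)
  refine (hs b).trans (Finset.card_le_card fun i hi => ?_)
  rw [Finset.mem_filter, sum_mul_blockForm_of_mem W hdisj γ hi]
  exact ⟨Finset.mem_univ _, hb⟩

end LinFormsM

/-! ### Asymptotics of the multi-form twist term -/

section AsymptoticsK

/-- `3·M^K·cos(π/(3M))^s ≤ 1/8` as soon as `s ≥ 4M²·(K·M + 4)` (`M ≥ 1`). -/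
theorem pow_twist_small (M K s : ℕ) (hM : 1 ≤ M) (hs : 4 * M ^ 2 * (K * M + 4) ≤ s) :
    3 * (M : ℝ) ^ K * Real.cos (Real.pi / (3 * M)) ^ s ≤ 1 / 8 := by
  haveI : NeZero M := ⟨by omega⟩
  have hMr : (1 : ℝ) ≤ M := by exact_mod_cast hM
  have hc0 : 0 ≤ Real.cos (Real.pi / (3 * M)) := TwistM.cos_nonneg M
  set t : ℝ := 1 / (4 * (M : ℝ) ^ 2) with ht
  have ht0 : 0 < t := by positivity
  -- `cos^s ≤ (1 - t)^s ≤ exp(-t)^s = exp(-(s t))`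
  have h1 : Real.cos (Real.pi / (3 * M)) ^ s ≤ (1 - t) ^ s := pow_le_pow_left₀ hc0 (cos_le_one_sub M hM) s
  have h1t : 0 ≤ 1 - t := by
    rw [ht]; rw [sub_nonneg, div_le_one (by positivity)]; nlinarith
  have h2 : (1 - t) ^ s ≤ Real.exp (-t) ^ s := pow_le_pow_left₀ h1t (Real.one_sub_le_exp_neg t) s
  have h3 : Real.exp (-t) ^ s = Real.exp (-((s : ℝ) * t)) := by rw [← Real.exp_nat_mul, mul_neg]
  -- `M^K ≤ exp(M)^K = exp(K M)`
  have h4 : (M : ℝ) ^ K ≤ Real.exp ((K : ℝ) * M) := by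
    rw [Real.exp_nat_mul]
    exact pow_le_pow_left₀ (by positivity) (by linarith [Real.add_one_le_exp (M : ℝ)]) K
  -- the exponent: `K M - s t ≤ -4`
  have hst : (K : ℝ) * M + 4 ≤ (s : ℝ) * t := by
    have hsr : (4 : ℝ) * (M : ℝ) ^ 2 * (K * M + 4) ≤ s := by exact_mod_cast hs
    rw [ht]
    rw [show (s : ℝ) * (1 / (4 * (M : ℝ) ^ 2)) = (s : ℝ) / (4 * (M : ℝ) ^ 2) by ring,
      le_div_iff₀ (by positivity)]
    nlinarith
  have h5 : 3 * (M : ℝ) ^ K * Real.cos (Real.pi / (3 * M)) ^ s ≤ 3 * Real.exp (-4) := by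
    have hA : (M : ℝ) ^ K * Real.cos (Real.pi / (3 * M)) ^ s ≤
        Real.exp ((K : ℝ) * M) * Real.exp (-((s : ℝ) * t)) := by
      refine mul_le_mul h4 (h1.trans (h2.trans h3.le)) (pow_nonneg hc0 s) (Real.exp_pos _).le
    rw [← Real.exp_add] at hA
    have hB : Real.exp ((K : ℝ) * M + -((s : ℝ) * t)) ≤ Real.exp (-4) := Real.exp_le_exp.2 (by linarith)
    linarith
  -- `exp(-4) ≤ 1/24`
  have h6 : Real.exp (-4) ≤ 1 / 24 := by
    rw [Real.exp_neg, ← one_div]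
    have he : (24 : ℝ) ≤ Real.exp 4 := by
      have h27 : (2.7 : ℝ) ≤ Real.exp 1 := by linarith [Real.exp_one_gt_d9]
      have hp4 : (2.7 : ℝ) ^ 4 ≤ Real.exp 1 ^ 4 := pow_le_pow_left₀ (by norm_num) h27 4
      have : Real.exp 4 = Real.exp 1 ^ 4 := by rw [← Real.exp_nat_mul]; norm_num
      rw [this]
      linarith [hp4, show (24 : ℝ) ≤ (2.7 : ℝ) ^ 4 by norm_num]
    exact one_div_le_one_div_of_le (by norm_num) he
  linarith

/-- The polylogarithmic bookkeeping: with `L ≥ 4`, `M ≤ L^{C+1}`, `K ≤ L^C`, `s ≥ L^{4C+6}` the hypothesis of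
`pow_twist_small` holds. [bookkeeping] -/
theorem block_hyp {L M K C s : ℕ} (hL : 4 ≤ L) (hM : M ≤ L ^ (C + 1)) (hK : K ≤ L ^ C) (hs : L ^ (4 * C + 6) ≤ s) :
    4 * M ^ 2 * (K * M + 4) ≤ s := by
  have hKM : K * M ≤ L ^ (2 * C + 1) := by
    calc K * M ≤ L ^ C * L ^ (C + 1) := Nat.mul_le_mul hK hM
      _ = L ^ (2 * C + 1) := by rw [← pow_add]; ring_nf
  have hM2 : M ^ 2 ≤ L ^ (2 * C + 2) := by
    calc M ^ 2 ≤ (L ^ (C + 1)) ^ 2 := Nat.pow_le_pow_left hM 2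
      _ = L ^ (2 * C + 2) := by rw [← pow_mul]; ring_nf
  have hL3 : 64 ≤ L ^ 3 := by
    calc 64 = 4 ^ 3 := by norm_num
      _ ≤ L ^ 3 := Nat.pow_le_pow_left hL 3
  have hpos : 1 ≤ L ^ (2 * C + 1) := Nat.one_le_pow _ _ (by omega)
  have hin : 4 * (L ^ (2 * C + 1) + 4) ≤ L ^ (2 * C + 4) := by
    have : L ^ (2 * C + 4) = L ^ (2 * C + 1) * L ^ 3 := by rw [← pow_add]
    rw [this]
    nlinarith
  calc 4 * M ^ 2 * (K * M + 4) ≤ 4 * L ^ (2 * C + 2) * (L ^ (2 * C + 1) + 4) := by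
        gcongr
    _ = L ^ (2 * C + 2) * (4 * (L ^ (2 * C + 1) + 4)) := by ring
    _ ≤ L ^ (2 * C + 2) * L ^ (2 * C + 4) := Nat.mul_le_mul_left _ hin
    _ = L ^ (4 * C + 6) := by rw [← pow_add]; ring_nf
    _ ≤ s := hs

end AsymptoticsK


/-! ### Finite forms (rev 3) -/

section FiniteFormsD

variable {n : ℕ}

/-- **Finite form of the `K`-forms bound**: for `3 ∤ M`, `n ≥ 4`, forms of minimum distance `s ≥ 4M²(KM+4)`, every table:
`#WIN(linStrat λ tab) ≤ (7/8)·2ⁿ`. -/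
theorem linStrat_card_win_le_fin {K M : ℕ} [NeZero M] (hM3 : M.Coprime 3) (hn : 4 ≤ n) (c : ℕ)
    (lam : Fin K → Fin n → ZMod M) {s : ℕ}
    (hdist : ∀ γ : Fin K → ZMod M, γ ≠ 0 → s ≤ (univ.filter fun i : Fin n => (∑ j, γ j * lam j i) ≠ 0).card)
    (hs : 4 * M ^ 2 * (K * M + 4) ≤ s) (tab : Fin (n + 1) → (Fin K → ZMod M) → Bool) :
    ((univ.filter fun u : Fin n → Bool => ringWinU c (linStrat lam tab) u = true).card : ℝ) ≤ (7 / 8) * (2 : ℝ) ^ n := by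
  have hmain := card_win_linStrat_le hM3 hn c lam hdist tab
  have hsmall := pow_twist_small M K s (Nat.one_le_iff_ne_zero.2 (NeZero.ne M)) hs
  have h2n : (0 : ℝ) ≤ (2 : ℝ) ^ n := by positivity
  nlinarith

/-- **Spread linear forms mod `M` lose** (explicit, field-free; `θ = 7/8`, `n ≥ 16`): `K ≤ (log₂ n)^C` forms mod any
`M ≤ (log₂ n)^C` coprime to `3` whose non-trivial combinations have `≥ (log₂ n)^{4C+6}` non-zero coefficients. -/
theorem spreadLinM_card_win_le (C : ℕ) {n : ℕ} (hn : 16 ≤ n) (c : ℕ) {K M : ℕ} [NeZero M] (hM3 : M.Coprime 3)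
    (hM : M ≤ (Nat.log 2 n) ^ C) (hK : K ≤ (Nat.log 2 n) ^ C) (lam : Fin K → Fin n → ZMod M)
    (hdist : ∀ γ : Fin K → ZMod M, γ ≠ 0 →
      (Nat.log 2 n) ^ (4 * C + 6) ≤ (univ.filter fun i : Fin n => (∑ j, γ j * lam j i) ≠ 0).card)
    (tab : Fin (n + 1) → (Fin K → ZMod M) → Bool) :
    ((univ.filter fun u : Fin n → Bool => ringWinU c (linStrat lam tab) u = true).card : ℝ) ≤ (7 / 8) * (2 : ℝ) ^ n := by
  have hL4 : 4 ≤ Nat.log 2 n := Nat.le_log_of_pow_le (by norm_num) (show 2 ^ 4 ≤ n by norm_num; exact hn)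
  have hM' : M ≤ (Nat.log 2 n) ^ (C + 1) := le_trans hM (Nat.pow_le_pow_right (by omega) (Nat.le_succ C))
  exact linStrat_card_win_le_fin hM3 (by omega) c lam hdist (block_hyp hL4 hM' hK le_rfl) tab

end FiniteFormsD

end Summit.QuantumAdvantage.QuantumAdvantage.Theorems.DigitDial
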